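import Summits.Ventures.PercRepro.RankLevelSetDepCountSplit

/-!
# PercRepro — THE PAIR MACHINERY OF THE `U`-COUNT, PER SIZE (p8, S3; part A of the GIANT-FLAT count)

`proofs/SUBCLAIM-S3-p8.md` §3d. The pairs `(C, B′)` of night-1's split count (RankLevelSetDepCountSplit: `C` a circuit,
`|C ∪ B′| = q + 1`, the dependent rank-`q` sets `B` of `≤ d` elements lie in the fibres `C ∪ B′ ⊆ B ⊆ cl(C ∪ B′)`) as
definitions (`pairsF`, `pairsSmall`, `pairsBig`, the level-`m` fibres `fibreLevel`), with night-1's cardinality bounds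
re-proved for them, and the per-SET form of the multiplicity: a rank-`q` set `B` of `m` elements lies in the level-`m`
fibre of at least `m − q` pairs (`card_pairs_ge`: a basis `I` of `B` and the fundamental circuit of each `x ∈ B ∖ I`
— the argument of night-1's multiplicity lemma `ncard_eRk_eq_ncard_eq_mul_le`, which stays the lemma of record), the
level-`m` double count `(m − q)·#{B : |B| = m} ≤ Σ_{pairs} #fibre_m` (`mul_card_levelF_le_sum`) and the fibre bound
`#fibre_m ≤ C(|cl ∖ (C ∪ B′)|, m − q − 1)` (`card_fibreLevel_le_choose`). Part B (`RankLevelSetDepCountGiantB`) splits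
the big class once more at the UNIQUE giant flat. Axioms: standard.
-/

open scoped Matroid

namespace PercRepro

namespace Matroid

open Set Finset

variable {α : Type} {M : _root_.Matroid α}

/-- The circuits of `M` with `k` elements, as a finset of sets. -/
noncomputable def circF (M : _root_.Matroid α) [M.Finite] (k : ℕ) : Finset (Set α) :=
  (M.ground_finite.finite_subsets.subset (fun C (hC : M.IsCircuit C ∧ C.ncard = k) => hC.1.subset_ground)).toFinset

/-- The `j`-element subsets of a finite set `S` (given as a finset), as a finset of sets. -/
noncomputable def subsF (S : Finset α) (j : ℕ) : Finset (Set α) :=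
  (S.powersetCard j).image (fun s : Finset α => (s : Set α))

/-- The ground set as a finset. -/
noncomputable def groundF (M : _root_.Matroid α) [M.Finite] : Finset α := M.ground_finite.toFinset

open scoped Classical in
/-- The pairs `(C, B′)`: `C` a circuit with `3 ≤ |C| ≤ q + 1`, `B′ ⊆ E` with `|B′| = q + 1 − |C|`, disjoint from
`C`, and `r(C ∪ B′) ≤ q`. -/
noncomputable def pairsF (M : _root_.Matroid α) [M.Finite] (q : ℕ) : Finset (Set α × Set α) :=
  ((Finset.Icc 3 (q + 1)).biUnion (fun k => circF M k ×ˢ subsF (groundF M) (q + 1 - k))).filter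
    (fun p => Disjoint p.2 p.1 ∧ M.eRk (p.1 ∪ p.2) ≤ q)

open scoped Classical in
/-- The rank-`q` subsets of the ground set with exactly `m` elements, as finsets. -/
noncomputable def levelF (M : _root_.Matroid α) [M.Finite] (q m : ℕ) : Finset (Finset α) :=
  ((groundF M).powersetCard m).filter (fun B => M.eRk (B : Set α) = (q : ℕ∞))

open scoped Classical in
/-- The level-`m` fibre of a pair: the rank-`q` `m`-element sets `B` with `C ∪ B′ ⊆ B ⊆ cl(C ∪ B′)`. -/
noncomputable def fibreLevel (M : _root_.Matroid α) [M.Finite] (q : ℕ) (p : Set α × Set α) (m : ℕ) :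
    Finset (Finset α) :=
  (levelF M q m).filter (fun B => p.1 ∪ p.2 ⊆ (B : Set α) ∧ (B : Set α) ⊆ M.closure (p.1 ∪ p.2))

/-- `↑(groundF M) = M.E`. -/
theorem coe_groundF (M : _root_.Matroid α) [M.Finite] : ((groundF M : Finset α) : Set α) = M.E :=
  Set.Finite.coe_toFinset _

/-- `#groundF M = |M.E|`. -/
theorem card_groundF (M : _root_.Matroid α) [M.Finite] : (groundF M).card = M.E.ncard :=
  (Set.ncard_eq_toFinset_card _ M.ground_finite).symm

/-- Membership in `circF`: the circuits with `k` elements. -/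
theorem mem_circF [M.Finite] {k : ℕ} {C : Set α} : C ∈ circF M k ↔ M.IsCircuit C ∧ C.ncard = k := by
  unfold circF
  rw [Set.Finite.mem_toFinset]
  rfl

/-- `#circF M k` is the number of `k`-element circuits. -/
theorem card_circF [M.Finite] (k : ℕ) : (circF M k).card = {C | M.IsCircuit C ∧ C.ncard = k}.ncard := by
  unfold circF
  exact (Set.ncard_eq_toFinset_card _ _).symm

/-- `#subsF S j ≤ C(#S, j)`. -/
theorem card_subsF_le (S : Finset α) (j : ℕ) : (subsF S j).card ≤ S.card.choose j := by
  unfold subsF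
  calc ((S.powersetCard j).image (fun s : Finset α => (s : Set α))).card ≤ (S.powersetCard j).card :=
        Finset.card_image_le
    _ = S.card.choose j := Finset.card_powersetCard j S

/-- A `j`-element subset of `↑S` lies in `subsF S j`. -/
theorem mem_subsF_of {S : Finset α} {j : ℕ} {B' : Set α} (hB' : B' ⊆ (S : Set α)) (hj : B'.ncard = j) :
    B' ∈ subsF S j := by
  have hfin : B'.Finite := S.finite_toSet.subset hB'
  unfold subsF
  rw [Finset.mem_image]
  refine ⟨hfin.toFinset, ?_, by simp⟩
  rw [Finset.mem_powersetCard]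
  refine ⟨?_, by rw [← Set.ncard_eq_toFinset_card B' hfin]; exact hj⟩
  intro x hx
  rw [Set.Finite.mem_toFinset] at hx
  exact_mod_cast hB' hx

open scoped Classical in
/-- The data of a pair. -/
theorem pairsF_data [M.Finite] {q : ℕ} {p : Set α × Set α} (hp : p ∈ pairsF M q) :
    p.1 ⊆ M.E ∧ p.2 ⊆ M.E ∧ (p.1 ∪ p.2).ncard = q + 1 ∧ M.eRk (p.1 ∪ p.2) ≤ q ∧
      ∃ k, k ∈ Finset.Icc 3 (q + 1) ∧ p.1 ∈ circF M k ∧ p.2.ncard = q + 1 - k := by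
  unfold pairsF at hp
  rw [Finset.mem_filter] at hp
  obtain ⟨hpmem, hdisj, hrk⟩ := hp
  rw [Finset.mem_biUnion] at hpmem
  obtain ⟨k, hk, hpk⟩ := hpmem
  rw [Finset.mem_product] at hpk
  obtain ⟨h1, h2⟩ := hpk
  have h1' := mem_circF.1 h1
  unfold subsF at h2
  rw [Finset.mem_image] at h2
  obtain ⟨s, hs, hs'⟩ := h2
  rw [Finset.mem_powersetCard] at hs
  have hp1E : p.1 ⊆ M.E := h1'.1.subset_ground
  have hp2E : p.2 ⊆ M.E := by rw [← hs', ← coe_groundF]; exact Finset.coe_subset.2 hs.1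
  have hp1fin : p.1.Finite := M.ground_finite.subset hp1E
  have hp2fin : p.2.Finite := M.ground_finite.subset hp2E
  have hp1c : p.1.ncard = k := h1'.2
  have hp2c : p.2.ncard = q + 1 - k := by rw [← hs', Set.ncard_coe_finset]; exact hs.2
  rw [Finset.mem_Icc] at hk
  refine ⟨hp1E, hp2E, ?_, hrk, k, Finset.mem_Icc.2 hk, h1, hp2c⟩
  rw [ncard_union_eq hdisj.symm hp1fin hp2fin, hp1c, hp2c]
  omega

open scoped Classical in
/-- **Multiplicity**: a rank-`q` set `B` of `m > q` elements (every circuit of `≥ 3` elements) lies in the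
level-`m` fibre of at least `m − q` pairs — one for each element of `B` outside a basis of `B`. -/
theorem card_pairs_ge [M.Finite] (q : ℕ) (hcirc : ∀ C, M.IsCircuit C → 3 ≤ C.encard)
    {B : Finset α} (hBE : (B : Set α) ⊆ M.E) (hBq : M.eRk (B : Set α) = (q : ℕ∞)) :
    B.card - q ≤ ((pairsF M q).filter (fun p => p.1 ∪ p.2 ⊆ (B : Set α) ∧
      (B : Set α) ⊆ M.closure (p.1 ∪ p.2))).card := by
  classical
  obtain ⟨I, hI⟩ := M.exists_isBasis (B : Set α) hBE
  have hIfin : I.Finite := B.finite_toSet.subset hI.subset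
  have hIcard : I.ncard = q := by
    have h := hI.encard_eq_eRk
    rw [hBq, ← hIfin.cast_ncard_eq] at h
    exact_mod_cast h
  have hIB : hIfin.toFinset ⊆ B := by
    intro x hx
    rw [Set.Finite.mem_toFinset] at hx
    exact_mod_cast hI.subset hx
  have hIcardF : hIfin.toFinset.card = q := by
    rw [← Set.ncard_eq_toFinset_card _ hIfin]; exact hIcard
  -- the map `x ↦ (C_x, (I ∪ {x}) ∖ C_x)` on `B ∖ I`
  let g : α → Set α × Set α := fun x => (M.fundCircuit x I, insert x I \ M.fundCircuit x I)
  have hcard : (B \ hIfin.toFinset).card = B.card - q := by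
    rw [Finset.card_sdiff, Finset.inter_eq_left.2 hIB, hIcardF]
  rw [← hcard]
  apply Finset.card_le_card_of_injOn g
  · intro x hx
    rw [Finset.mem_coe, Finset.mem_sdiff, Set.Finite.mem_toFinset] at hx
    obtain ⟨hxB, hxI⟩ := hx
    have hxE : x ∈ M.E := hBE (by exact_mod_cast hxB)
    have hxcl : x ∈ M.closure I := hI.subset_closure (by exact_mod_cast hxB)
    have hC : M.IsCircuit (M.fundCircuit x I) := hI.indep.fundCircuit_isCircuit hxcl hxI
    have hCsub : M.fundCircuit x I ⊆ insert x I := M.fundCircuit_subset_insert x I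
    have hxC : x ∈ M.fundCircuit x I := M.mem_fundCircuit x I
    have hinsfin : (insert x I).Finite := hIfin.insert x
    have hinscard : (insert x I).ncard = q + 1 := by
      rw [Set.ncard_insert_of_notMem hxI hIfin, hIcard]
    have hCfin : (M.fundCircuit x I).Finite := hinsfin.subset hCsub
    have hC3 : 3 ≤ (M.fundCircuit x I).ncard := by
      have := hcirc _ hC
      rw [← hCfin.cast_ncard_eq] at this
      exact_mod_cast this
    have hCle : (M.fundCircuit x I).ncard ≤ q + 1 := by
      rw [← hinscard]; exact ncard_le_ncard hCsub hinsfin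
    have hunion : M.fundCircuit x I ∪ (insert x I \ M.fundCircuit x I) = insert x I := by
      rw [Set.union_sdiff_cancel hCsub]
    have hinsB : insert x I ⊆ (B : Set α) := Set.insert_subset (by exact_mod_cast hxB) hI.subset
    have hinsE : insert x I ⊆ M.E := hinsB.trans hBE
    have hdisj : Disjoint (insert x I \ M.fundCircuit x I) (M.fundCircuit x I) := Set.disjoint_sdiff_left
    have hrk : M.eRk (insert x I) ≤ q := by
      have h1 : insert x I ⊆ M.closure I := Set.insert_subset hxcl (M.subset_closure I (hI.subset.trans hBE))
      calc M.eRk (insert x I) ≤ M.eRk (M.closure I) := M.eRk_mono h1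
        _ = M.eRk I := M.eRk_closure_eq I
        _ = M.eRk (B : Set α) := hI.eRk_eq_encard.symm ▸ hI.indep.eRk_eq_encard ▸ rfl
        _ = q := hBq
    have hBcl : (B : Set α) ⊆ M.closure (insert x I) :=
      hI.subset_closure.trans (M.closure_subset_closure (Set.subset_insert x I))
    have hdiffcard : (insert x I \ M.fundCircuit x I).ncard = q + 1 - (M.fundCircuit x I).ncard := by
      rw [ncard_sdiff hCsub (hinsfin.subset hCsub), hinscard]
    rw [Finset.mem_coe, Finset.mem_filter]
    refine ⟨?_, ?_, ?_⟩
    · unfold pairsF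
      rw [Finset.mem_filter]
      refine ⟨?_, hdisj, by simpa [g, hunion] using hrk⟩
      rw [Finset.mem_biUnion]
      refine ⟨(M.fundCircuit x I).ncard, by rw [Finset.mem_Icc]; omega, ?_⟩
      rw [Finset.mem_product]
      refine ⟨mem_circF.2 ⟨hC, rfl⟩, ?_⟩
      apply mem_subsF_of
      · rw [coe_groundF]; exact Set.sdiff_subset.trans hinsE
      · exact hdiffcard
    · show M.fundCircuit x I ∪ (insert x I \ M.fundCircuit x I) ⊆ (B : Set α)
      rw [hunion]; exact hinsB
    · show (B : Set α) ⊆ M.closure (M.fundCircuit x I ∪ (insert x I \ M.fundCircuit x I))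
      rw [hunion]; exact hBcl
  · intro x hx y hy hxy
    rw [Finset.mem_coe, Finset.mem_sdiff, Set.Finite.mem_toFinset] at hx hy
    have h1 : M.fundCircuit x I ∪ (insert x I \ M.fundCircuit x I) =
        M.fundCircuit y I ∪ (insert y I \ M.fundCircuit y I) := by
      have := congrArg (fun p : Set α × Set α => p.1 ∪ p.2) hxy
      simpa [g] using this
    rw [Set.union_sdiff_cancel (M.fundCircuit_subset_insert x I),
      Set.union_sdiff_cancel (M.fundCircuit_subset_insert y I)] at h1
    have hxy' : x ∈ insert y I := h1 ▸ Set.mem_insert x I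
    rcases hxy' with h | h
    · exact h
    · exact absurd h hx.2

end Matroid

end PercRepro
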